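import Summits.QuantumAdvantage.QuantumAdvantage.Theses.CubicForrelation
import Summits.QuantumAdvantage.QuantumAdvantage.Theorems.CubicForrelationSignedCubicForrelationInPrBPPStructureNeedsDillon
import Literature.Computability.QuantumComplexity.ForrelationSignTransport
import Literature.Computability.QuantumComplexity.ForrelationDerivativeTables
import Literature.Computability.QuantumComplexity.SignedForrelationGadget
import Summits.QuantumAdvantage.QuantumAdvantage.Theorems.NearExactIsExact.Negative.ProjectionConcat

/-!
# `NearExactIsExact` (stmt-QuantumAdvantage-14043) — negative side: the parity hypothesis, the odd-`n` branch,
  and a degree-free ceiling `2√2/3` for half-divisible spectra at odd `n`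

Disprover seat `b2b-cforr-disprove-g22` (2026-08-21).  HONEST FRAMING: kernel-checked NEGATIVE / STRUCTURAL LEMMAS about
the crux `Summit.QuantumAdvantage.QuantumAdvantage.Theses.CubicForrelation.NearExactIsExact`
(`∃ θ < 1, ∀ even n, ∀ cubic f g, Φ(f,g) > θ ⇒ Φ(f,g) = 1`).  They are NOT summit progress and do not decide the crux;
they say exactly what the hypothesis `Even n` does and does not do, and close one odd-`n` habitat.

* `forrelation_eq_S`, `forrelation_sq_ne_one_of_odd` — `Φ(f,g) = S / √(2^{3n})` with `S ∈ ℤ`, so at ODD `n` no pair of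
  Boolean functions whatsoever has `Φ = ±1` (`S² = 2^{3n}` is impossible, `3n` odd).
* `nearExactIsExact_iff_allParity` — the hypothesis `Even n` of the crux is NOT load-bearing: the crux is EQUIVALENT
  to the same isolation statement over all `n` (with `θ' = √(max θ 0)`): a near-exact cubic pair on an odd number of
  bits, squared by the direct sum (`forrelation_directSum`, `isDegLeFun_directSum`), is a near-exact NON-exact cubic
  pair on an even number of bits.  Equivalently (`exists_odd_ceiling_of_nearExactIsExact`) the crux forces a uniform
  ceiling `θ' < 1` on `Φ` over ALL cubic pairs on an odd number of bits, and (`nearExactIsExact_false_of_oddFamily`)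
  an odd-`n` cubic family with `Φ → 1` refutes the crux — the odd branch is a legitimate
  disproof habitat (census in the seat's DISPROOF §29: the maximal capacity `Σ_a |W_g(a)| / 2^{3n/2}` — hence `max Φ` —
  is `5/(4√2) = 0.8839…` exactly at `n = 3, 5` over all functions and at `n = 7` over all cubics (via the 12
  `GL(7,2)`-classes of `RM(3,7)/RM(2,7)`), attained by `x₁x₂x₃ ⊕ bent`; nothing above it was found at `n = 9, 11, 13`).
* `forrelation_le_of_two_pow_dvd_W` — the DEGREE-FREE odd ceiling: at `n = 2m+1`, if every Walsh coefficient of `g`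
  is divisible by `2^m` (e.g. every `g` that is affine on the cosets of an `m`-dimensional subspace — the odd
  Maiorana–McFarland shape `x·π(y) ⊕ h(y)`, `|x| = m`, `|y| = m+1`, ANY `π`, `h`), then `Φ(f,g) ≤ 2√2/3 < 1` for EVERY
  `f`: writing `W_g = 2^m k` with `k ∈ ℤ`, Parseval gives `Σ k² = 2·2^n` and the integer inequality `3|k| ≤ k² + 2`
  gives `Σ |k| ≤ (4/3)2^n`; so such families never approach `1` and cannot serve the odd habitat — an odd-`n` refutation needs
  spectra finer than `2^m ℤ`.
* `W_mmOdd`, `forrelation_mmOdd_le` — the instance that matters: `W_{x·π(w) ⊕ h(w)}(c ‖ b) = 2^m Σ_{π(w)=c} (-1)^{h(w) ⊕ w·b}`,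
  so EVERY odd Maiorana–McFarland function (any `π`, any `h`) has `Φ(f,g) ≤ 2√2/3` against every `f`.

References (orientation; everything is proved from the tree): S. Aaronson, A. Ambainis, Forrelation, SIAM J. Comput. 47
(2018) §1.1.1 (definition of `Φ`, direct sums); C. Carlet, *Boolean Functions for Cryptography and Coding Theory* (CUP
2020) §6.1 (Maiorana–McFarland shape, Walsh divisibility); R. O'Donnell, *Analysis of Boolean Functions* (2014) §1.4
(Parseval). [folklore]
-/

set_option linter.dupNamespace false -- D-0017: single-problem summit ⇒ `QuantumAdvantage.QuantumAdvantage` by design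

noncomputable section

namespace Summit.QuantumAdvantage.QuantumAdvantage.Theorems.NearExactIsExact.Negative.OddParity

open Finset
open Literature.Computability.QuantumComplexity
open Literature.Computability.QuantumComplexity.DerivativeWalsh (W fsum phi_eq_fsum fsum_eq_sum_mul_W sum_W_sq)
open Literature.Computability.QuantumComplexity.BuzetChailloux (phi_signOf)
open Summit.QuantumAdvantage.QuantumAdvantage.Theses.CubicForrelation (NearExactIsExact)
open Summit.QuantumAdvantage.QuantumAdvantage.Theorems.SignedCubicForrelationInPrBPP.DirectSumDefect
  (isDegLeFun_directSum)

variable {n : ℕ}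

/-! ### `Φ` is an integer over `√(2^{3n})` -/

/-- The integer sign `(-1)^{[b]}`. [folklore] -/
def sgn (b : Bool) : ℤ := if b then -1 else 1

/-- `signOf` is the cast of `sgn`. [folklore] -/
theorem signOf_eq_sgn (b : Bool) : signOf b = (sgn b : ℝ) := by
  cases b <;> simp [signOf, sgn]

/-- The integer twist `(-1)^{x·y}`. [folklore] -/
def twistZ (x y : Fin n → Bool) : ℤ := ∏ l, if x l && y l then (-1 : ℤ) else 1

/-- `twist` is the cast of `twistZ`. [folklore] -/
theorem twist_eq_twistZ (x y : Fin n → Bool) : twist x y = (twistZ x y : ℝ) := by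
  unfold twist twistZ
  rw [Int.cast_prod]
  refine prod_congr rfl fun l _ => ?_
  split_ifs <;> simp

/-- The unnormalised forrelation sum as an INTEGER: `S(f,g) = Σ_{x,y} (-1)^{f(x) + x·y + g(y)}`.
[cite: AaronsonAmbainis2018, §1.1.1] -/
def S (f g : (Fin n → Bool) → Bool) : ℤ := ∑ x, ∑ y, sgn (f x) * twistZ x y * sgn (g y)

/-- `Φ(f,g) = S(f,g) / √(2^{3n})` with `S(f,g) ∈ ℤ`. [cite: AaronsonAmbainis2018, §1.1.1] -/
theorem forrelation_eq_S (f g : (Fin n → Bool) → Bool) :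
    forrelation f g = (Real.sqrt ((2 : ℝ) ^ (3 * n)))⁻¹ * (S f g : ℝ) := by
  unfold forrelation S
  congr 1
  push_cast
  refine sum_congr rfl fun x _ => sum_congr rfl fun y _ => ?_
  rw [signOf_eq_sgn, signOf_eq_sgn, twist_eq_twistZ]

/-- No perfect square is twice a power of four: `a² ≠ 2^{2j+1}`. [folklore] -/
theorem sq_ne_two_pow_odd (a j : ℕ) : a ^ 2 ≠ 2 ^ (2 * j + 1) := by
  intro h
  have hdvd : (2 ^ j) ^ 2 ∣ a ^ 2 := ⟨2, by rw [h]; ring⟩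
  obtain ⟨t, rfl⟩ := (Nat.pow_dvd_pow_iff two_ne_zero).1 hdvd
  have ht : t ^ 2 = 2 := by
    have h2 : (2 : ℕ) ^ (2 * j + 1) = (2 ^ j) ^ 2 * 2 := by ring
    rw [h2, mul_pow] at h
    exact Nat.eq_of_mul_eq_mul_left (by positivity) h
  rcases Nat.lt_or_ge t 2 with hlt | hge
  · interval_cases t <;> simp at ht
  · nlinarith

/-- **Odd `n` is never exact**: `Φ(f,g)² ≠ 1` for every pair of Boolean functions on an odd number of bits
(`S² = 2^{3n}` with `3n` odd is impossible). [folklore] -/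
theorem forrelation_sq_ne_one_of_odd (hn : Odd n) (f g : (Fin n → Bool) → Bool) : forrelation f g ^ 2 ≠ 1 := by
  intro h
  have hc : Real.sqrt ((2 : ℝ) ^ (3 * n)) ^ 2 = (2 : ℝ) ^ (3 * n) := Real.sq_sqrt (by positivity)
  have hpos : (0 : ℝ) < (2 : ℝ) ^ (3 * n) := by positivity
  rw [forrelation_eq_S, mul_pow, inv_pow, hc, inv_mul_eq_div, div_eq_one_iff_eq hpos.ne'] at h
  have hZ : (S f g) ^ 2 = 2 ^ (3 * n) := by exact_mod_cast h
  have hN : (S f g).natAbs ^ 2 = 2 ^ (3 * n) := by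
    have := congrArg Int.natAbs hZ
    rwa [Int.natAbs_pow, Int.natAbs_pow] at this
  obtain ⟨r, hr⟩ := hn
  refine sq_ne_two_pow_odd (S f g).natAbs (3 * r + 1) ?_
  rw [hN, hr]
  ring_nf

/-- At odd `n`, `Φ(f,g) ≠ 1`. [folklore] -/
theorem forrelation_ne_one_of_odd (hn : Odd n) (f g : (Fin n → Bool) → Bool) : forrelation f g ≠ 1 := by
  intro h
  exact forrelation_sq_ne_one_of_odd hn f g (by rw [h]; norm_num)

/-! ### The parity hypothesis is not load-bearing -/

/-- The direct-sum square of a function: `x ↦ f(x|₁) ⊕ f(x|₂)` on `n + n` bits. [cite: AaronsonAmbainis2018, §1.1.1] -/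
def dsq (f : (Fin n → Bool) → Bool) : (Fin (n + n) → Bool) → Bool :=
  fun x => xor (f fun i => x (Fin.castAdd n i)) (f fun j => x (Fin.natAdd n j))

/-- `Φ(f ⊕ f, g ⊕ g) = Φ(f,g)²`. [cite: AaronsonAmbainis2018, §1.1.1] -/
theorem forrelation_dsq (f g : (Fin n → Bool) → Bool) : forrelation (dsq f) (dsq g) = forrelation f g ^ 2 := by
  rw [sq]
  exact forrelation_directSum f g f g

/-- Squaring keeps degree `≤ 3`. [folklore] -/
theorem isDegLeFun_dsq {d : ℕ} {f : (Fin n → Bool) → Bool} (hf : IsDegLeFun d f) : IsDegLeFun d (dsq f) :=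
  isDegLeFun_directSum hf hf

/-- **`Even n` is not load-bearing**: the crux is equivalent to isolation of exactness over all `n`.  (`⇒`: with
`θ' = √(max θ 0)`, a cubic pair with `Φ > θ'` on `n` bits has the cubic square pair with `Φ² > θ` on the even number
`n + n` of bits, so `Φ² = 1`; at even `n` the crux applies directly, at odd `n` this contradicts
`forrelation_sq_ne_one_of_odd`, so no such pair exists.) [folklore] -/
theorem nearExactIsExact_iff_allParity :
    NearExactIsExact ↔ ∃ θ : ℝ, θ < 1 ∧ ∀ n : ℕ, ∀ f g : (Fin n → Bool) → Bool,
      IsDegLeFun 3 f → IsDegLeFun 3 g → θ < forrelation f g → forrelation f g = 1 := by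
  constructor
  · rintro ⟨θ, hθ, H⟩
    set a : ℝ := max θ 0 with ha
    have ha0 : 0 ≤ a := le_max_right _ _
    have ha1 : a < 1 := max_lt hθ one_pos
    have hθa : θ ≤ a := le_max_left _ _
    have hsq : Real.sqrt a ^ 2 = a := Real.sq_sqrt ha0
    have hs0 : 0 ≤ Real.sqrt a := Real.sqrt_nonneg a
    have hs1 : Real.sqrt a < 1 := by
      rw [← Real.sqrt_one]
      exact Real.sqrt_lt_sqrt ha0 ha1
    have has : a ≤ Real.sqrt a := by nlinarith
    refine ⟨Real.sqrt a, hs1, fun n f g hf hg hlt => ?_⟩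
    rcases Nat.even_or_odd n with he | ho
    · exact H n he f g hf hg (lt_of_le_of_lt (hθa.trans has) hlt)
    · exfalso
      have h2 : θ < forrelation (dsq f) (dsq g) := by
        rw [forrelation_dsq]
        calc θ ≤ a := hθa
          _ = Real.sqrt a ^ 2 := hsq.symm
          _ < forrelation f g ^ 2 := by gcongr
      have h1 := H (n + n) ⟨n, rfl⟩ (dsq f) (dsq g) (isDegLeFun_dsq hf) (isDegLeFun_dsq hg) h2
      rw [forrelation_dsq] at h1
      exact forrelation_sq_ne_one_of_odd ho f g h1
  · rintro ⟨θ, hθ, H⟩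
    exact ⟨θ, hθ, fun n _ f g hf hg hlt => H n f g hf hg hlt⟩

/-- **What the crux says at odd `n`**: a uniform ceiling `θ' < 1` on `Φ` over all cubic pairs on an odd number of
bits (none of them is exact). [folklore] -/
theorem exists_odd_ceiling_of_nearExactIsExact (h : NearExactIsExact) :
    ∃ θ : ℝ, θ < 1 ∧ ∀ n : ℕ, Odd n → ∀ f g : (Fin n → Bool) → Bool,
      IsDegLeFun 3 f → IsDegLeFun 3 g → forrelation f g ≤ θ := by
  obtain ⟨θ, hθ, H⟩ := nearExactIsExact_iff_allParity.1 h
  refine ⟨θ, hθ, fun n hn f g hf hg => ?_⟩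
  by_contra hlt
  exact forrelation_ne_one_of_odd hn f g (H n f g hf hg (lt_of_not_ge hlt))

/-- **Negative lemma (odd branch)**: an odd-`n` near-exact cubic family — cubic pairs on ODD numbers of bits with `Φ`
arbitrarily close to `1` — refutes the crux.  The habitat is not known to be inhabited (the seat's census: `max Φ =
5/(4√2) ≈ 0.884` exactly at `n = 3, 5`, and at `n = 7` over all cubics; nothing above it found at `n = 9, 11, 13`); by
`forrelation_le_of_two_pow_dvd_W` its witnesses cannot have `2^{(n-1)/2}`-divisible spectra. [folklore] -/
theorem nearExactIsExact_false_of_oddFamily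
    (hfam : ∀ θ : ℝ, θ < 1 → ∃ n : ℕ, Odd n ∧ ∃ f g : (Fin n → Bool) → Bool,
      IsDegLeFun 3 f ∧ IsDegLeFun 3 g ∧ θ < forrelation f g) :
    ¬ NearExactIsExact := by
  intro h
  obtain ⟨θ, hθ, H⟩ := exists_odd_ceiling_of_nearExactIsExact h
  obtain ⟨n, hn, f, g, hf, hg, hlt⟩ := hfam θ hθ
  exact absurd (H n hn f g hf hg) (not_le.2 hlt)

/-! ### The degree-free odd ceiling `2√2/3` for `2^m`-divisible spectra (`n = 2m+1`) -/

/-- The integer inequality behind the ceiling: `3|k| ≤ k² + 2` (equality iff `|k| ∈ {1,2}`). [folklore] -/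
theorem three_mul_abs_le (k : ℤ) : 3 * |k| ≤ k ^ 2 + 2 := by
  rcases le_or_gt |k| 1 with h | h
  · nlinarith [abs_nonneg k, sq_abs k, mul_nonneg (sub_nonneg.2 h) (by linarith : (0 : ℤ) ≤ 2 - |k|)]
  · have h2 : 2 ≤ |k| := by
      have : (1 : ℤ) + 1 ≤ |k| := Int.add_one_le_of_lt h
      linarith
    nlinarith [sq_abs k, mul_nonneg (by linarith : (0 : ℤ) ≤ |k| - 1) (sub_nonneg.2 h2)]

/-- `√(2^{3(2m+1)}) = 2^{3m+1} √2`. [folklore] -/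
theorem sqrt_two_pow_three_odd (m : ℕ) :
    Real.sqrt ((2 : ℝ) ^ (3 * (2 * m + 1))) = (2 : ℝ) ^ (3 * m + 1) * Real.sqrt 2 := by
  have h : (2 : ℝ) ^ (3 * (2 * m + 1)) = ((2 : ℝ) ^ (3 * m + 1)) ^ 2 * 2 := by ring
  rw [h, Real.sqrt_mul' _ (by norm_num : (0 : ℝ) ≤ 2), Real.sqrt_sq (by positivity)]

/-- **Degree-free odd ceiling.**  At `n = 2m+1`, if every Walsh coefficient `W_g(y) = Σ_x (-1)^{g(x)+x·y}` is
divisible by `2^m`, then `Φ(f,g) ≤ 2√2/3` for EVERY `f` (no degree hypothesis on either side).  Covers every `g`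
affine on the cosets of an `m`-dimensional subspace (odd Maiorana–McFarland shape). Proof: `W_g = 2^m k`, Parseval
`Σ k² = 2·2ⁿ`, `3|k| ≤ k² + 2` pointwise, so `Σ_y |W_g(y)| ≤ 2^m (4/3) 2ⁿ` and `Φ ≤ 2^m (4/3) 2ⁿ / (2^{3m+1}√2) = 2√2/3`.
[folklore] -/
theorem forrelation_le_of_two_pow_dvd_W (n m : ℕ) (hn : n = 2 * m + 1) (f g : (Fin n → Bool) → Bool)
    (hW : ∀ y, ∃ k : ℤ, W (fun x => signOf (g x)) y = (2 : ℝ) ^ m * k) :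
    forrelation f g ≤ 2 * Real.sqrt 2 / 3 := by
  choose k hk using hW
  set F : (Fin n → Bool) → ℝ := fun x => signOf (f x) with hF
  set G : (Fin n → Bool) → ℝ := fun x => signOf (g x) with hG
  -- (1) `fsum F G ≤ Σ |W_G| = 2^m Σ |k|`
  have h1 : fsum F G ≤ (2 : ℝ) ^ m * ∑ y, |(k y : ℝ)| := by
    rw [fsum_eq_sum_mul_W, mul_sum]
    refine sum_le_sum fun y _ => ?_
    calc F y * W G y ≤ |F y * W G y| := le_abs_self _
      _ = |W G y| := by rw [abs_mul, hF, abs_signOf, one_mul]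
      _ = (2 : ℝ) ^ m * |(k y : ℝ)| := by rw [hk y, abs_mul, abs_of_pos (by positivity)]
  -- (2) Parseval: `Σ k² = 2·2ⁿ`
  have hP : ∑ y, W G y ^ 2 = (2 : ℝ) ^ n * 2 ^ n := by
    rw [sum_W_sq]
    congr 1
    have : ∀ y, G y ^ 2 = 1 := fun y => by rw [hG]; exact BuzetChailloux.signOf_sq (g y)
    simp_rw [this, sum_const, card_univ, Fintype.card_fun, Fintype.card_bool, Fintype.card_fin]
    simp
  have hk2 : ∑ y, (k y : ℝ) ^ 2 = 2 * (2 : ℝ) ^ n := by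
    have e : ∀ y, W G y ^ 2 = (2 : ℝ) ^ (2 * m) * (k y : ℝ) ^ 2 := fun y => by rw [hk y]; ring
    simp_rw [e] at hP
    rw [← mul_sum] at hP
    have h22 : (2 : ℝ) ^ n * 2 ^ n = (2 : ℝ) ^ (2 * m) * (2 * 2 ^ n) := by rw [hn]; ring
    rw [h22] at hP
    exact mul_left_cancel₀ (by positivity) hP
  -- (3) the integer inequality, summed
  have h3 : 3 * ∑ y, |(k y : ℝ)| ≤ ∑ y, (k y : ℝ) ^ 2 + 2 * (2 : ℝ) ^ n := by
    have hcard : ∑ _y : Fin n → Bool, (2 : ℝ) = 2 * (2 : ℝ) ^ n := by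
      rw [sum_const, card_univ, Fintype.card_fun, Fintype.card_bool, Fintype.card_fin, nsmul_eq_mul]
      push_cast
      ring
    rw [← hcard, ← sum_add_distrib, mul_sum]
    refine sum_le_sum fun y _ => ?_
    have := three_mul_abs_le (k y)
    have hc : ((3 * |k y| : ℤ) : ℝ) ≤ ((k y ^ 2 + 2 : ℤ) : ℝ) := by exact_mod_cast this
    push_cast at hc
    exact hc
  have h4 : ∑ y, |(k y : ℝ)| ≤ 4 * (2 : ℝ) ^ n / 3 := by
    rw [hk2] at h3
    linarith
  -- (4) assemble
  have hs2 : Real.sqrt 2 * Real.sqrt 2 = 2 := Real.mul_self_sqrt (by norm_num)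
  have hs : Real.sqrt ((2 : ℝ) ^ (3 * n)) = (2 : ℝ) ^ (3 * m + 1) * Real.sqrt 2 := by
    rw [hn]; exact sqrt_two_pow_three_odd m
  rw [← phi_signOf, phi_eq_fsum, hs]
  calc ((2 : ℝ) ^ (3 * m + 1) * Real.sqrt 2)⁻¹ * fsum F G
      ≤ ((2 : ℝ) ^ (3 * m + 1) * Real.sqrt 2)⁻¹ * ((2 : ℝ) ^ m * (4 * (2 : ℝ) ^ n / 3)) := by
        refine mul_le_mul_of_nonneg_left (h1.trans ?_) (by positivity)
        exact mul_le_mul_of_nonneg_left h4 (by positivity)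
    _ = 2 * Real.sqrt 2 / 3 := by
        have e : (2 : ℝ) ^ m * (4 * (2 : ℝ) ^ n / 3) = 4 * (2 : ℝ) ^ (3 * m + 1) / 3 := by rw [hn]; ring
        have hne : (2 : ℝ) ^ (3 * m + 1) * Real.sqrt 2 ≠ 0 := by positivity
        rw [e, inv_mul_eq_div, div_eq_div_iff hne (by norm_num : (3 : ℝ) ≠ 0)]
        linear_combination (-2 * (2 : ℝ) ^ (3 * m + 1)) * hs2


/-! ### The odd Maiorana–McFarland shape has `2^m`-divisible spectrum, hence `Φ ≤ 2√2/3` -/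

section MMOdd
open Summit.QuantumAdvantage.QuantumAdvantage.Theorems.NearExactIsExact.Negative.ProjectionConcat
  (ipb signOf_ipb sum_twist_twist)

variable {m : ℕ}

/-- The odd Maiorana–McFarland shape on `m + (m+1)` bits: `g(x ‖ w) = x·π(w) ⊕ h(w)`, `x ∈ 𝔽₂^m`, `w ∈ 𝔽₂^{m+1}`,
for an ARBITRARY map `π` (no injectivity, no degree constraint) and an arbitrary `h`. [cite: Carlet2020, §6.1] -/
def mmOdd (π : (Fin (m + 1) → Bool) → (Fin m → Bool)) (h : (Fin (m + 1) → Bool) → Bool)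
    (z : Fin (m + (m + 1)) → Bool) : Bool :=
  xor (ipb (fun i => z (Fin.castAdd (m + 1) i)) (π fun j => z (Fin.natAdd m j))) (h fun j => z (Fin.natAdd m j))

/-- **Walsh transform of the odd MM shape**: `W_g(c ‖ b) = 2^m · Σ_{w : π(w) = c} (-1)^{h(w) ⊕ w·b}`. [folklore] -/
theorem W_mmOdd (π : (Fin (m + 1) → Bool) → (Fin m → Bool)) (h : (Fin (m + 1) → Bool) → Bool)
    (c : Fin m → Bool) (b : Fin (m + 1) → Bool) :
    W (fun z => signOf (mmOdd π h z)) (Fin.append c b) =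
      (2 : ℝ) ^ m * ∑ w : Fin (m + 1) → Bool, (if π w = c then signOf (h w) * twist w b else 0) := by
  unfold W
  rw [sum_append, sum_comm]
  simp only [mmOdd, Fin.append_left, Fin.append_right, signOf_xor, signOf_ipb, twist_append]
  rw [mul_sum]
  refine sum_congr rfl fun w _ => ?_
  have e : ∑ x : Fin m → Bool, twist x (π w) * signOf (h w) * (twist x c * twist w b) =
      (signOf (h w) * twist w b) * ∑ x : Fin m → Bool, twist x (π w) * twist x c := by
    rw [mul_sum]
    exact sum_congr rfl fun x _ => by ring
  rw [e, sum_twist_twist]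
  by_cases hw : π w = c
  · rw [if_pos hw, if_pos hw]; ring
  · rw [if_neg hw, if_neg hw]; ring

/-- The spectrum of the odd MM shape lies in `2^m ℤ`. [folklore] -/
theorem W_mmOdd_dvd (π : (Fin (m + 1) → Bool) → (Fin m → Bool)) (h : (Fin (m + 1) → Bool) → Bool)
    (y : Fin (m + (m + 1)) → Bool) :
    ∃ k : ℤ, W (fun z => signOf (mmOdd π h z)) y = (2 : ℝ) ^ m * k := by
  refine ⟨∑ w : Fin (m + 1) → Bool,
    (if π w = (fun i => y (Fin.castAdd (m + 1) i)) then sgn (h w) * twistZ w (fun j => y (Fin.natAdd m j)) else 0), ?_⟩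
  have hy : Fin.append (fun i => y (Fin.castAdd (m + 1) i)) (fun j => y (Fin.natAdd m j)) = y :=
    Fin.append_castAdd_natAdd (f := y)
  rw [← hy, W_mmOdd, hy]
  push_cast
  refine congrArg _ (sum_congr rfl fun w _ => ?_)
  split_ifs <;> simp [signOf_eq_sgn, twist_eq_twistZ]

/-- **The odd Maiorana–McFarland habitat is capped at `2√2/3`** — for EVERY `π`, `h` and EVERY partner `f`
(degree-free): `Φ(f, x·π(w) ⊕ h(w)) ≤ 2√2/3 < 1` on `m + (m+1)` bits.  In particular no family of this shape can
serve `nearExactIsExact_false_of_oddFamily`. [folklore] -/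
theorem forrelation_mmOdd_le (π : (Fin (m + 1) → Bool) → (Fin m → Bool)) (h : (Fin (m + 1) → Bool) → Bool)
    (f : (Fin (m + (m + 1)) → Bool) → Bool) :
    forrelation f (mmOdd π h) ≤ 2 * Real.sqrt 2 / 3 :=
  forrelation_le_of_two_pow_dvd_W (m + (m + 1)) m (by ring) f (mmOdd π h) (W_mmOdd_dvd π h)

end MMOdd

end Summit.QuantumAdvantage.QuantumAdvantage.Theorems.NearExactIsExact.Negative.OddParity

end
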